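import Mathlib
import Literature.Analysis.FluidPDE.LerayL3ExistenceFromFiniteEnergy
import Literature.Analysis.FluidPDE.RusinSverakLerayAeEqKatoHolds
import Summits.NavierStokesRegularity.NavierStokesRegularity.Theorems.L3TimeExponentPincerCritModulusNoSwirlSelection
import Summits.NavierStokesRegularity.NavierStokesRegularity.Theorems.L3TimeExponentPincerNormalisedFamily
import Summits.NavierStokesRegularity.NavierStokesRegularity.Theorems.L3TimeExponentPincerRegularPointUniformBound
import Summits.NavierStokesRegularity.NavierStokesRegularity.Theorems.L3TimeExponentPincerRecedingAxis
import Summits.NavierStokesRegularity.NavierStokesRegularity.Theorems.L3TimeExponentPincerConvergingAxes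
import Summits.NavierStokesRegularity.NavierStokesRegularity.Theorems.L3TimeExponentPincerSwirlFreeLimit
import Summits.NavierStokesRegularity.NavierStokesRegularity.Theorems.L3TimeExponentPincerSpaceTimeAxisymmetry
import Summits.NavierStokesRegularity.NavierStokesRegularity.Theorems.L3TimeExponentPincerSpaceTimeSwirlFree
import Summits.NavierStokesRegularity.NavierStokesRegularity.Theorems.L3TimeExponentPincerVectorTestConvergence
import Summits.NavierStokesRegularity.NavierStokesRegularity.Theorems.L3TimeExponentPincerTranslationInvariantLimit
import HarnessLib.Audit
import HarnessLib

/-!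
# L3TimeExponentPincer — the (J) reduction: `CritSmoothingNoSwirlB ⇐ (SFL³)` (assembly)

Support kernel for the crux `L3CascadeJaw` (item stmt-NavierStokesRegularity-19499) of route
`L3TimeExponentPincer`: the compactness reduction (J) of planner nsreg-p2's ROUND-12 §2b /
Addendum A §A.2 («THE CRITICAL MODULUS»).  The velocity-indexed critical smoothing modulus in the
swirl-free class, `CritSmoothingNoSwirlB` (`…Theorems.L3TimeExponentPincerCritModulus`: some
`Φ` with `‖u(t)‖_∞ ≤ Φ(‖u₀‖₃) t^{-1/2}` along every Tao-class swirl-free axisymmetric solution),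
FOLLOWS from the regularity at positive times of swirl-free axisymmetric local Leray solutions
(Jia–Šverák class `𝒩(u₀)`) with `L³` data — the node `(SFL³)` typed in
`…Theorems.L3TimeExponentPincerSFL3` (review-queued when this file lands; here the hypothesis is
spelled out verbatim, the one-line wrapper `critSmoothingNoSwirlB_of_sfl3` follows the node).

The proof assembles the lineage's kernel lemmas over PROVED tree theorems only (no undischarged
named fact): step 0 `exists_family_points_of_not_critSmoothingNoSwirlB` (selection), step 1
`…NormalisedFamily.normalised_family` (parabolic normalisation into GLOBAL local Leray solutions,
via the swirl-free global regularity `exists_isTaoSolutionOn_of_noSwirl` and the Leray–Hopf →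
local-Leray bridge), **K₃** `jia_sverak_leray_weak_stability_holds` (Jia–Šverák 2013 compactness
with identification of the limit datum), `not_isRegularPoint_of_unbounded` (quantitative stability
of regularity, from the proved CKN/RRS Thm. 15.3 and the pressure decay estimate), the
receding-axis lemma `ae_eq_zero_of_tendsto_of_isAxisymmetricAbout_receding` (KNSS 2009 pf. of
Thm. 6.2 in weak form) with weak–strong uniqueness `leray_solution_ae_zero_of_datum_ae_zero`
(**W**, proved), and the converging-axes / swirl-free / space–time symmetry passages
`ae_isAxisymmetricAbout_of_tendsto`, `ae_swirlAbout_eq_zero_of_tendsto`,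
`ae_axisymmetricAbout_of_L3loc`, `ae_swirlAbout_eq_zero_of_L3loc`.

* `critSmoothingNoSwirlB_of_regularity` — the reduction, hypothesis = `(SFL³)` verbatim.
* `exists_subseq_tendsto_atTop_or_bddAbove`, `norm_eq_cylRadius_of_apply_two`,
  `locallyIntegrableOn_of_isLocalLeraySolution` — bookkeeping.

Sources: H. Jia, V. Šverák, SIAM J. Math. Anal. 45 (2013) = arXiv:1201.1592, §3 (Lemmas 3, 5, 6,
7) and §4; W. Rusin, V. Šverák, J. Funct. Anal. 260 (2011) = arXiv:0911.0500, §4 (proof of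
Cor. 4.3: normalisation `λ_k u(λ_k² t, λ_k x - x_k)`); G. Koch, N. Nadirashvili, G. Seregin,
V. Šverák, Acta Math. 203 (2009), proof of Thm. 6.2 (receding axes).
WHAT THIS IS NOT: not NS regularity or blow-up — a reduction between two OPEN statements of the
swirl-free class (`CritSmoothingNoSwirlB`, `(SFL³)`: neither asserted nor refuted); hard cores
15453 / 1964 (data WITH swirl) not touched; the crux `L3CascadeJaw` is untouched; no crux claim.
-/

noncomputable section

open MeasureTheory Set Function Filter Topology TopologicalSpace Metric
open scoped ENNReal NNReal ContDiff RealInnerProductSpace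

namespace Summit.NavierStokesRegularity.NavierStokesRegularity.Theorems.L3TimeExponentPincerCritModulusNoSwirlReduction

open Literature.Analysis.FluidPDE
open Summit.NavierStokesRegularity.NavierStokesRegularity.Theorems.L3TimeExponentPincerCritModulus
open Summit.NavierStokesRegularity.NavierStokesRegularity.Theorems.L3TimeExponentPincerCritModulusNoSwirlSelection
open Summit.NavierStokesRegularity.NavierStokesRegularity.Theorems.L3TimeExponentPincerRegularPointUniformBound
open Summit.NavierStokesRegularity.NavierStokesRegularity.Theorems.L3TimeExponentPincerRecedingAxis
open Summit.NavierStokesRegularity.NavierStokesRegularity.Theorems.L3TimeExponentPincerConvergingAxes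
open Summit.NavierStokesRegularity.NavierStokesRegularity.Theorems.L3TimeExponentPincerSwirlFreeLimit
open Summit.NavierStokesRegularity.NavierStokesRegularity.Theorems.L3TimeExponentPincerSpaceTimeAxisymmetry
open Summit.NavierStokesRegularity.NavierStokesRegularity.Theorems.L3TimeExponentPincerSpaceTimeSwirlFree
open Summit.NavierStokesRegularity.NavierStokesRegularity.Theorems.L3TimeExponentPincerVectorTestConvergence
open Summit.NavierStokesRegularity.NavierStokesRegularity.Theorems.L3TimeExponentPincerTranslationInvariantLimit
open Summit.NavierStokesRegularity.NavierStokesRegularity.Theorems.L3TimeExponentPincerNormalisedFamily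


/-- Dichotomy for a real sequence: a subsequence tending to `+∞`, or an upper bound. -/
theorem exists_subseq_tendsto_atTop_or_bddAbove (r : ℕ → ℝ) :
    (∃ φ : ℕ → ℕ, StrictMono φ ∧ Tendsto (fun k => r (φ k)) atTop atTop) ∨ BddAbove (range r) := by
  by_cases h : BddAbove (range r)
  · exact Or.inr h
  left
  have hfreq : ∀ n : ℕ, ∃ᶠ k in atTop, (n : ℝ) < r k := by
    intro n
    rw [Filter.frequently_atTop]
    intro k₀
    set M : ℝ := n + ∑ j ∈ Finset.range k₀, |r j| with hM
    obtain ⟨_, ⟨k, rfl⟩, hk⟩ := not_bddAbove_iff.1 h M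
    refine ⟨k, ?_, ?_⟩
    · by_contra hlt
      rw [not_le] at hlt
      have h1 : r k ≤ ∑ j ∈ Finset.range k₀, |r j| :=
        (le_abs_self (r k)).trans
          (Finset.single_le_sum (f := fun j => |r j|) (fun j _ => abs_nonneg (r j))
            (Finset.mem_range.2 hlt))
      have h2 : (0 : ℝ) ≤ n := Nat.cast_nonneg n
      linarith
    · have h2 : ∑ j ∈ Finset.range k₀, |r j| ≥ 0 := Finset.sum_nonneg fun j _ => abs_nonneg _
      linarith
  obtain ⟨φ, hφ, hφn⟩ := Filter.extraction_forall_of_frequently hfreq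
  exact ⟨φ, hφ, tendsto_atTop_mono (fun n => (hφn n).le) tendsto_natCast_atTop_atTop⟩

/-- The norm of a horizontal vector is its cylindrical radius. -/
theorem norm_eq_cylRadius_of_apply_two {b : (EuclideanSpace ℝ (Fin 3))} (hb : b 2 = 0) : ‖b‖ = cylRadius b := by
  rw [EuclideanSpace.norm_eq, cylRadius]
  congr 1
  simp [Fin.sum_univ_three, hb]

/-- A local Leray solution is locally integrable on `{t > 0}` (it has a weak spatial gradient on
the open slab). -/
theorem locallyIntegrableOn_of_isLocalLeraySolution {u₀ : (EuclideanSpace ℝ (Fin 3)) → (EuclideanSpace ℝ (Fin 3))} {U : ℝ → (EuclideanSpace ℝ (Fin 3)) → (EuclideanSpace ℝ (Fin 3))}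
    {P : ℝ → (EuclideanSpace ℝ (Fin 3)) → ℝ} (h : IsLocalLeraySolution 1 u₀ U P) :
    LocallyIntegrableOn (uncurry U) {z : ℝ × (EuclideanSpace ℝ (Fin 3)) | 0 < z.1} volume := by
  obtain ⟨G, hG⟩ := h.exists_hasWeakSpatialGradientOn
  have hset : ((slab (EuclideanSpace ℝ (Fin 3)) (Ioi 0) isOpen_Ioi : Opens (ℝ × (EuclideanSpace ℝ (Fin 3)))) :
      Set (ℝ × (EuclideanSpace ℝ (Fin 3)))) = {z : ℝ × (EuclideanSpace ℝ (Fin 3)) | 0 < z.1} := by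
    ext z; simp [slab]
  rw [← hset]
  exact hG.locallyIntegrableOn

/-- **The (J) reduction: regularity of swirl-free axisymmetric local Leray solutions with `L³`
data implies the velocity-indexed critical smoothing modulus in the swirl-free class.**  Suppose
that every local Leray solution `(U, P) ∈ 𝒩(u₀)` (`ν = 1`) with `u₀ ∈ L³` weakly divergence
free, such that `u₀` and `U` are a.e. axisymmetric and swirl-free about a common vertical axis
`bl + ℝ e_z`, is regular at every point of `{t > 0}` (the hypothesis is VERBATIM the node
`…Theorems.L3TimeExponentPincerSFL3.SFL3`, review-queued as this file lands; the one-line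
wrapper follows it).  Then `CritSmoothingNoSwirlB` holds.  Proof (Jia–Šverák 2013 §3–4 /
Rusin–Šverák 2011 §4 scheme, memo ROUND-12 §2b/§A.2): if not, step 0 gives a blowing-up
Tao-class swirl-free family; step 1 normalises it into GLOBAL local Leray solutions
`v_k ∈ 𝒩(a_k)`, `‖a_k‖₃ ≤ A`, exactly symmetric about vertical axes through horizontal points
`b_k`, continuous on `{s > 0}`, with `‖v_k(1,0)‖ > k`; **K₃** (`jia_sverak_leray_weak_stability_holds`)
extracts `v_{σ(k)} → U` in the situation of Rusin–Šverák's Prop. 2.2 on `(0,∞) × ℝ³` with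
`a_{σ(k)} ⇀ a'`, `(U, P) ∈ 𝒩(a')`; quantitative stability of regularity
(`not_isRegularPoint_of_unbounded`) makes `(1, 0)` a SINGULAR point of `U`.  If the axes recede
(`cylRadius b_{σ(k)} → ∞` along a subsequence), the receding-axis lemma gives `a' = 0` a.e.,
hence `U = 0` a.e. (`leray_solution_ae_zero_of_datum_ae_zero`, weak–strong uniqueness) and
`(1, 0)` is regular — contradiction; otherwise the axes converge along a subsequence to some `bl`,
the datum and the solution are a.e. symmetric about `bl + ℝ e_z` (converging-axes / swirl-free
/ space–time symmetry lemmas), and the hypothesis makes `(1, 0)` regular — contradiction. -/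
theorem critSmoothingNoSwirlB_of_regularity
    (hS : ∀ (bl : (EuclideanSpace ℝ (Fin 3))) (u₀ : (EuclideanSpace ℝ (Fin 3)) → (EuclideanSpace ℝ (Fin 3))) (U : ℝ → (EuclideanSpace ℝ (Fin 3)) → (EuclideanSpace ℝ (Fin 3))) (P : ℝ → (EuclideanSpace ℝ (Fin 3)) → ℝ),
      MemLp u₀ 3 volume → IsWeaklyDivFree u₀ → IsLocalLeraySolution 1 u₀ U P →
      (∀ θ : ℝ, ∀ᵐ x ∂volume, u₀ (bl + rotZ θ (x - bl)) = rotZ θ (u₀ x)) →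
      (∀ᵐ x ∂volume, (x - bl) 0 * u₀ x 1 - (x - bl) 1 * u₀ x 0 = 0) →
      (∀ θ : ℝ, ∀ᵐ z : ℝ × (EuclideanSpace ℝ (Fin 3)) ∂volume, 0 < z.1 →
        U z.1 (bl + rotZ θ (z.2 - bl)) = rotZ θ (U z.1 z.2)) →
      (∀ᵐ z : ℝ × (EuclideanSpace ℝ (Fin 3)) ∂volume, 0 < z.1 →
        (z.2 - bl) 0 * U z.1 z.2 1 - (z.2 - bl) 1 * U z.1 z.2 0 = 0) →
      ∀ z : ℝ × (EuclideanSpace ℝ (Fin 3)), 0 < z.1 → IsRegularPoint U z) :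
    CritSmoothingNoSwirlB := by
  by_contra hneg
  obtain ⟨A, hA, hfam⟩ := exists_family_points_of_not_critSmoothingNoSwirlB hneg
  have hB := normalised_family hfam
  choose a v π b ha3 hadiv haA hv hb2 hax hasw hvax hvsw hvcont hvbig using hB
  obtain ⟨σ, a', U, P, q, hσ, ha'3, ha'div, -, hweak, hUP, hsit, -, -⟩ :=
    jia_sverak_leray_weak_stability_holds A.toNNReal a v π
      (fun k => ⟨ha3 k, hadiv k, by simpa [ENNReal.ofReal] using haA k⟩) hv
  have hslab : ((slab (EuclideanSpace ℝ (Fin 3)) (Ioi 0) isOpen_Ioi : Opens (ℝ × (EuclideanSpace ℝ (Fin 3)))) :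
      Set (ℝ × (EuclideanSpace ℝ (Fin 3)))) = {z : ℝ × (EuclideanSpace ℝ (Fin 3)) | 0 < z.1} := by
    ext z; simp [slab]
  -- (1,0) singular for U
  have h10 : ((1 : ℝ), (0 : (EuclideanSpace ℝ (Fin 3)))) ∈ (slab (EuclideanSpace ℝ (Fin 3)) (Ioi 0) isOpen_Ioi :
      Opens (ℝ × (EuclideanSpace ℝ (Fin 3)))) := by
    show ((1 : ℝ), (0 : (EuclideanSpace ℝ (Fin 3)))) ∈ ((slab (EuclideanSpace ℝ (Fin 3)) (Ioi 0) isOpen_Ioi :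
      Opens (ℝ × (EuclideanSpace ℝ (Fin 3)))) : Set (ℝ × (EuclideanSpace ℝ (Fin 3))))
    rw [hslab]; show (0 : ℝ) < 1; exact one_pos
  have hsing : ¬ IsRegularPoint U (1, 0) := by
    refine not_isRegularPoint_of_unbounded hsit (fun k => ?_) h10
      (z := fun _ => ((1 : ℝ), (0 : (EuclideanSpace ℝ (Fin 3))))) tendsto_const_nhds ?_
    · rw [hslab]; exact hvcont (σ k)
    · refine tendsto_atTop_mono (fun k => (hvbig (σ k)).le) ?_
      exact tendsto_natCast_atTop_atTop.comp hσ.tendsto_atTop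
  -- uniform local `L¹` bounds and local integrability of the data
  have haLI : ∀ k, LocallyIntegrable (a k) volume := fun k => (ha3 k).locallyIntegrable (by norm_num)
  have ha'LI : LocallyIntegrable a' volume := ha'3.locallyIntegrable (by norm_num)
  have hbd : ∀ R : ℝ, ∃ C : ℝ, ∀ k, ∫ x in closedBall (0 : (EuclideanSpace ℝ (Fin 3))) R, ‖a k x‖ ≤ C := fun R =>
    exists_setIntegral_norm_le_of_eLpNorm_le (p := 3) (by norm_num) (fun k => (ha3 k).1)
      ENNReal.ofReal_ne_top haA R
  have hconv : ∀ g : (EuclideanSpace ℝ (Fin 3)) → ℝ, ContDiff ℝ ∞ g → HasCompactSupport g →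
      Tendsto (fun k => ∫ x, g x • a (σ k) x) atTop (𝓝 (∫ x, g x • a' x)) := fun g hg hgs =>
    tendsto_integral_smul_of_tendsto_integral_inner (fun k => haLI (σ k)) ha'LI hweak hg hgs
  -- local integrability of the solutions on `{t > 0}`
  have hvLI : ∀ k, LocallyIntegrableOn (uncurry (v k)) {z : ℝ × (EuclideanSpace ℝ (Fin 3)) | 0 < z.1} volume := fun k =>
    locallyIntegrableOn_of_isLocalLeraySolution (hv k)
  have hULI : LocallyIntegrableOn (uncurry U) {z : ℝ × (EuclideanSpace ℝ (Fin 3)) | 0 < z.1} volume :=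
    locallyIntegrableOn_of_isLocalLeraySolution hUP
  -- dichotomy on the axes
  rcases exists_subseq_tendsto_atTop_or_bddAbove (fun k => cylRadius (b (σ k))) with
    ⟨φ, hφ, hrec⟩ | hbdd
  · -- Case A: receding axes ⇒ `a' = 0` a.e. ⇒ `U = 0` a.e. ⇒ `(1,0)` regular
    have ha'0 : a' =ᵐ[volume] 0 := by
      refine ae_eq_zero_of_tendsto_of_isAxisymmetricAbout_receding (p := 3) (by norm_num)
        (by norm_num) (v := fun k => a (σ (φ k))) (a := fun k => b (σ (φ k)))
        (fun k θ x => hax _ θ x) hrec (fun k => haLI _) (fun R => ?_) ha'3 (fun g hg hgs => ?_)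
      · obtain ⟨C, hC⟩ := hbd R
        exact ⟨C, fun k => hC _⟩
      · exact (hconv g hg hgs).comp hφ.tendsto_atTop
    have hU0 := leray_solution_ae_zero_of_datum_ae_zero leray_solution_ae_eq_kato_holds one_pos
      hUP ha'0 2
    apply hsing
    refine ⟨1 / 2, by norm_num, ?_⟩
    have hsub : parabolicCylinderCentered (1 / 2 : ℝ) ((1 : ℝ), (0 : (EuclideanSpace ℝ (Fin 3)))) ⊆
        Ioo (0 : ℝ) 2 ×ˢ (univ : Set (EuclideanSpace ℝ (Fin 3))) := by
      intro w hw
      rw [mem_parabolicCylinderCentered] at hw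
      refine ⟨⟨?_, ?_⟩, mem_univ _⟩
      · nlinarith [hw.1.1]
      · nlinarith [hw.1.2]
    have hae : uncurry U =ᵐ[volume.restrict (parabolicCylinderCentered (1 / 2 : ℝ)
        ((1 : ℝ), (0 : (EuclideanSpace ℝ (Fin 3)))))] 0 := ae_restrict_of_ae_restrict_of_subset hsub hU0
    rw [eLpNorm_congr_ae hae, eLpNorm_zero]
    exact ENNReal.zero_lt_top
  · -- Case B: converging axes (along a subsequence) ⇒ symmetric limit ⇒ (SFL³) ⇒ `(1,0)` regular
    obtain ⟨M, hM⟩ := hbdd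
    have hmem : ∀ k, b (σ k) ∈ closedBall (0 : (EuclideanSpace ℝ (Fin 3))) M := fun k => by
      rw [mem_closedBall, dist_zero_right, norm_eq_cylRadius_of_apply_two (hb2 (σ k))]
      exact hM ⟨k, rfl⟩
    obtain ⟨bl, -, φ, hφ, hbl⟩ := tendsto_subseq_of_bounded (isBounded_closedBall) hmem
    have hsitφ := hsit.comp_strictMono hφ
    have hblφ : Tendsto (fun k => b (σ (φ k))) atTop (𝓝 bl) := hbl
    -- the datum is symmetric about the limit axis
    have hd_ax : ∀ θ : ℝ, ∀ᵐ x ∂volume, a' (bl + rotZ θ (x - bl)) = rotZ θ (a' x) := fun θ =>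
      ae_isAxisymmetricAbout_of_tendsto (v := fun k => a (σ (φ k))) (a := fun k => b (σ (φ k)))
        (fun k θ' x => hax _ θ' x) hblφ (fun k => haLI _)
        (fun R => by obtain ⟨C, hC⟩ := hbd R; exact ⟨C, fun k => hC _⟩) ha'LI
        (fun g hg hgs => (hconv g hg hgs).comp hφ.tendsto_atTop) θ
    have hd_sw : ∀ᵐ x ∂volume, (x - bl) 0 * a' x 1 - (x - bl) 1 * a' x 0 = 0 :=
      ae_swirlAbout_eq_zero_of_tendsto (v := fun k => a (σ (φ k))) (a := fun k => b (σ (φ k)))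
        (fun k x => hasw _ x) hblφ (fun k => haLI _) ha'LI
        (fun g hg hgs => (hconv g hg hgs).comp hφ.tendsto_atTop)
    -- the solution is symmetric about the limit axis
    have hL3 : ∀ K ⊆ {z : ℝ × (EuclideanSpace ℝ (Fin 3)) | 0 < z.1}, IsCompact K →
        Tendsto (fun k => ∫⁻ z in K, ‖v (σ (φ k)) z.1 z.2 - U z.1 z.2‖ₑ ^ (3 : ℕ)) atTop (𝓝 0) :=
      fun K hK hKc => hsitφ.tendsto_lintegral K (by rw [hslab]; exact hK) hKc
    have hs_ax : ∀ θ : ℝ, ∀ᵐ z : ℝ × (EuclideanSpace ℝ (Fin 3)) ∂volume, 0 < z.1 →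
        U z.1 (bl + rotZ θ (z.2 - bl)) = rotZ θ (U z.1 z.2) := fun θ =>
      ae_axisymmetricAbout_of_L3loc hL3 (fun k => hvLI _) hULI (fun k t ht θ' x => hvax _ t ht θ' x)
        hblφ θ
    have hs_sw : ∀ᵐ z : ℝ × (EuclideanSpace ℝ (Fin 3)) ∂volume, 0 < z.1 →
        (z.2 - bl) 0 * U z.1 z.2 1 - (z.2 - bl) 1 * U z.1 z.2 0 = 0 :=
      ae_swirlAbout_eq_zero_of_L3loc hL3 (fun k => hvLI _) hULI (fun k t ht x => hvsw _ t ht x) hblφ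
    exact hsing (hS bl a' U P ha'3 ha'div hUP hd_ax hd_sw hs_ax hs_sw (1, 0) one_pos)

end Summit.NavierStokesRegularity.NavierStokesRegularity.Theorems.L3TimeExponentPincerCritModulusNoSwirlReduction

end
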